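import Literature.NumberTheory.PAdicHodge.AinfRamifiedDivisionTransport
import Literature.NumberTheory.PAdicHodge.FormalLogFrobeniusSecondKindTransport
import Mathlib.FieldTheory.Finite.Basic
import HarnessLib

/-!
# The CM-fibre transport for the K★ cells: `𝒪_D`-arithmetic (`ϖ ∣ p`, `p ∉ 𝒪_Dˣ`, `aᵖ ≡ a (mod ϖ)`), the Frobenius-twist congruence of the
# explicit models, and the second-kind property of BOTH frame generators `log_{E₀}`, `log_{E₀}(Xᵖ)` on `Ŵ_D`

Topic `Literature/NumberTheory/PAdicHodge` (theorems only; no definition, no named fact, no instance, no `sorry`). Sequel of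
`AinfRamifiedDivisionTransport` (the transport `v ↦ w` and `map_explicitModel_eq_map_cmFibre`) and `FormalLog(Frobenius)SecondKindTransport`.
Setting: `D` an Eisenstein root datum over the `p`-adic field `F` (`𝒪_D = ℤ_p[ϖ] = CoeffDisc D`, `ϖ = CoeffDisc.of D (AdjoinRoot.root D.poly)`), the
explicit cell model `W = ⟨0, 0, 0, a·ϖ^{r₄}, b·ϖ^{r₆}⟩` (`a, b ∈ ℤ`; K★: `(p; e, r₄, r₆) ∈ {(5;3,1,0), (5;6,4,0), (7;4,0,2)}`) and its CM fibre
`E₀ = ⟨0, 0, 0, a·[r₄ = 0], b·[r₆ = 0]⟩ ∈ WeierstrassCurve ℤ`.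

* §1 `𝒪_D`-arithmetic: `root_dvd_natCast_coeffDisc` (`ϖ ∣ p`, Eisenstein), `not_isUnit_natCast_coeffDisc` (`p ∉ 𝒪_Dˣ`, `‖p‖ < 1` in `ℂ_F`),
  `intCast_pow_sub_intCast_mem_span_root` (`aᵖ − a ∈ (ϖ)` for `a ∈ ℤ`, Fermat);
* §2 `map_frobeniusTwist_explicitModel_eq_map_cmFibre` — **`W^{(p)} ≡ E₀ (mod ϖ)`** for the explicit models (hypothesis `hW'E` of
  `norm_coeff_formalLog_pow_cocycle_le`);
* §3 the cell corollaries, with `φ_D : 𝒪_D → ℂ_F` (norm `≤ 1`, `‖φ_D ϖ‖ = ‖ϖ‖ < 1`): ★ `norm_coeff_formalLog_cocycle_le_explicitModel` and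
  ★ `norm_coeff_formalLog_pow_cocycle_le_explicitModel` — **`log_{E₀}` and `log_{E₀}(Xᵖ)` are of the second kind on `Ŵ_D`** (cocycle coefficients
  bounded by `M` resp. `max(M_p, M)` for any constants with `‖ϖ‖^j ≤ M‖j‖`, `‖p‖^j ≤ M_p‖j‖`), and ★ `exists_unique_cmFibre_divisionSeq_explicitModel`
  — every exact `[p]_{W_D}`-tower has a unique exact `[p]_{E₀}`-tower at distance `≤ ‖ϖ‖`.

Purpose: line `kato_lever`, crux K★ `stmt-BirchSwinnertonDyer-22226`, memo `Lines/kato-lever-K2-ramified-cm-transport.md` (§6 DAG, steps T1/T4a at the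
cells). BSD / K★ are not proved by any of this; nothing about elliptic curves over number fields is proved here.

## References
* J.-P. Serre, *Local Fields* (1979), Ch. I §6 Prop. 17–18 (Eisenstein equations, `𝒪 = ℤ_p[ϖ]`). [SerreLocalFields1979]
* N. M. Katz, *Crystalline cohomology, Dieudonné modules, and Jacobi sums* (1981), Key Lemma 5.1.3, Thm. 5.1.4. [Katz1981CrystallineDieudonne]
* J. H. Silverman, *The Arithmetic of Elliptic Curves* (2009), VII.§1, IV.1. [SilvermanAEC2009]
-/

noncomputable section

open scoped Classical
open PowerSeries Field ValuativeRel

namespace Literature.NumberTheory.PAdicHodge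

open Literature.NumberTheory.GaloisRepresentations Literature.NumberTheory.GaloisRepresentations.IsNonarchimedeanLocalField
open Literature.NumberTheory.GaloisRepresentations.LubinTate Literature.NumberTheory.EllipticCurves Literature.RingTheory.FormalGroups

variable {F : Type} [Field F] [ValuativeRel F] [TopologicalSpace F] [IsNonarchimedeanLocalField F] [CharZero F]
  {p : ℕ} [hpp : Fact p.Prime] {hp : valuation F p < 1} (D : EisensteinRoot F p hp)

/-! ## §1 `𝒪_D`-arithmetic -/

/-- **`ϖ ∣ p` in `𝒪_D = ℤ_p[ϖ]`** (Eisenstein: `0 = f(ϖ) = p·u + Σ_{i ≥ 1} cᵢϖⁱ` with `u ∈ ℤ_pˣ`). [cite: SerreLocalFields1979, Ch. I §6 Prop. 17] -/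
theorem root_dvd_natCast_coeffDisc :
    EisensteinRoot.CoeffDisc.of D (AdjoinRoot.root D.poly) ∣ (p : EisensteinRoot.CoeffDisc D) := by
  suffices h : AdjoinRoot.root D.poly ∣ (p : D.Coeff) by
    simpa using map_dvd (EisensteinRoot.CoeffDisc.of D) h
  have h := AdjoinRoot.eval₂_root D.poly
  rw [Polynomial.eval₂_eq_sum_range, Finset.sum_range_succ', pow_zero, mul_one] at h
  obtain ⟨u, hu⟩ := D.exists_coeff_zero_eq_mul_unit
  have h1 : (AdjoinRoot.of D.poly) (D.poly.coeff 0) = (p : D.Coeff) * AdjoinRoot.of D.poly (u : ℤ_[p]) := by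
    rw [hu, map_mul, map_natCast]
  have hunit : IsUnit (AdjoinRoot.of D.poly (u : ℤ_[p])) := u.isUnit.map _
  have h2 : (p : D.Coeff) * AdjoinRoot.of D.poly (u : ℤ_[p]) =
      -∑ i ∈ Finset.range D.poly.natDegree, AdjoinRoot.of D.poly (D.poly.coeff (i + 1)) * AdjoinRoot.root D.poly ^ (i + 1) := by
    rw [← h1]; exact eq_neg_of_add_eq_zero_right h
  have h3 : AdjoinRoot.root D.poly ∣ (p : D.Coeff) * AdjoinRoot.of D.poly (u : ℤ_[p]) := by
    rw [h2]
    refine (dvd_neg).2 (Finset.dvd_sum fun i _ => ?_)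
    rw [pow_succ']
    exact Dvd.dvd.mul_left (dvd_mul_right _ _) _
  exact (hunit.dvd_mul_right).1 h3

/-- `p ∈ (ϖ)` in `𝒪_D`. [cite: SerreLocalFields1979, Ch. I §6 Prop. 17] -/
theorem natCast_mem_span_root_coeffDisc :
    (p : EisensteinRoot.CoeffDisc D) ∈ Ideal.span {EisensteinRoot.CoeffDisc.of D (AdjoinRoot.root D.poly)} :=
  Ideal.mem_span_singleton.2 (root_dvd_natCast_coeffDisc D)

/-- **`p` is not a unit of `𝒪_D`** (its image in `ℂ_F` has norm `< 1`, while units of `𝒪_D` map into `𝒪_{ℂ_F}ˣ`). [cite: SerreLocalFields1979, Ch. I §6 Prop. 17] -/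
theorem not_isUnit_natCast_coeffDisc : ¬ IsUnit (p : EisensteinRoot.CoeffDisc D) := by
  intro h
  obtain ⟨q, hq⟩ := h.exists_right_inv
  have h1 := congrArg (fun z => ((algebraMap (EisensteinRoot.CoeffDisc D) (CBall F) z : CBall F) : CompletedAlgClosure F)) hq
  simp only [map_mul, map_natCast, map_one, Subring.coe_mul, Subring.coe_natCast, Subring.coe_one] at h1
  have h2 : ‖(p : CompletedAlgClosure F)‖ * ‖((algebraMap (EisensteinRoot.CoeffDisc D) (CBall F) q : CBall F) : CompletedAlgClosure F)‖ = 1 := by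
    rw [← norm_mul, h1, norm_one]
  have h3 : ‖((algebraMap (EisensteinRoot.CoeffDisc D) (CBall F) q : CBall F) : CompletedAlgClosure F)‖ ≤ 1 := (mem_unitBall_iff _).mp (Subtype.mem _)
  have h4 : ‖(p : CompletedAlgClosure F)‖ < 1 := norm_natCast_C_lt_one hp
  nlinarith [norm_nonneg (p : CompletedAlgClosure F), norm_nonneg (((algebraMap (EisensteinRoot.CoeffDisc D) (CBall F) q : CBall F) : CompletedAlgClosure F))]

/-- **Fermat in `𝒪_D`**: `aᵖ − a ∈ (ϖ)` for an integer `a` (`p ∣ aᵖ − a` and `ϖ ∣ p`). [cite: SerreLocalFields1979, Ch. I §6 Prop. 17] -/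
theorem intCast_pow_sub_intCast_mem_span_root (a : ℤ) :
    ((a : EisensteinRoot.CoeffDisc D) ^ p - a) ∈ Ideal.span {EisensteinRoot.CoeffDisc.of D (AdjoinRoot.root D.poly)} := by
  have hdvd : (p : ℤ) ∣ a ^ p - a := by
    rw [← ZMod.intCast_zmod_eq_zero_iff_dvd]
    push_cast
    rw [ZMod.pow_card, sub_self]
  obtain ⟨k, hk⟩ := hdvd
  have h : ((a : EisensteinRoot.CoeffDisc D) ^ p - a) = (p : EisensteinRoot.CoeffDisc D) * (k : EisensteinRoot.CoeffDisc D) := by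
    exact_mod_cast congrArg (fun z : ℤ => (z : EisensteinRoot.CoeffDisc D)) hk
  rw [h]
  exact Ideal.mul_mem_right _ _ (natCast_mem_span_root_coeffDisc D)

/-! ## §2 The Frobenius twist of the explicit model is congruent to the CM fibre -/

/-- ★ **`W^{(p)} ≡ E₀ (mod ϖ)` for the explicit cell models**: the Frobenius twist `⟨0ᵖ, 0ᵖ, 0ᵖ, (aϖ^{r₄})ᵖ, (bϖ^{r₆})ᵖ⟩` of `W = ⟨0,0,0,aϖ^{r₄},bϖ^{r₆}⟩` and the
CM fibre `E₀ = ⟨0,0,0,a[r₄=0],b[r₆=0]⟩` have the same reduction modulo `ϖ` (`ϖ^{rp} ≡ 0` for `r > 0`, `aᵖ ≡ a`). This is the hypothesis `hW'E` of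
`norm_coeff_formalLog_pow_cocycle_le`. [cite: SilvermanAEC2009, VII.§1] -/
theorem map_frobeniusTwist_explicitModel_eq_map_cmFibre (a b : ℤ) (r₄ r₆ : ℕ) :
    (⟨(0 : EisensteinRoot.CoeffDisc D) ^ p, (0 : EisensteinRoot.CoeffDisc D) ^ p, (0 : EisensteinRoot.CoeffDisc D) ^ p,
        (algebraMap ℤ (EisensteinRoot.CoeffDisc D) a * EisensteinRoot.CoeffDisc.of D (AdjoinRoot.root D.poly) ^ r₄) ^ p,
        (algebraMap ℤ (EisensteinRoot.CoeffDisc D) b * EisensteinRoot.CoeffDisc.of D (AdjoinRoot.root D.poly) ^ r₆) ^ p⟩ :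
        WeierstrassCurve (EisensteinRoot.CoeffDisc D)).map
      (Ideal.Quotient.mk (Ideal.span {EisensteinRoot.CoeffDisc.of D (AdjoinRoot.root D.poly)})) =
    ((⟨0, 0, 0, if r₄ = 0 then a else 0, if r₆ = 0 then b else 0⟩ : WeierstrassCurve ℤ).map
        (algebraMap ℤ (EisensteinRoot.CoeffDisc D))).map
      (Ideal.Quotient.mk (Ideal.span {EisensteinRoot.CoeffDisc.of D (AdjoinRoot.root D.poly)})) := by
  set ϱ := EisensteinRoot.CoeffDisc.of D (AdjoinRoot.root D.poly) with hϱ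
  set π := Ideal.Quotient.mk (Ideal.span {ϱ}) with hπ
  have hπϱ : π ϱ = 0 := Ideal.Quotient.eq_zero_iff_mem.2 (Ideal.mem_span_singleton_self _)
  have hp0 : p ≠ 0 := hpp.out.ne_zero
  have hfermat : ∀ c : ℤ, π ((c : EisensteinRoot.CoeffDisc D) ^ p) = π (c : EisensteinRoot.CoeffDisc D) := fun c => by
    rw [← sub_eq_zero, ← map_sub, Ideal.Quotient.eq_zero_iff_mem]
    exact intCast_pow_sub_intCast_mem_span_root D c
  have hpow : ∀ (c : ℤ) (r : ℕ), π (((c : EisensteinRoot.CoeffDisc D) * ϱ ^ r) ^ p) =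
      π ((if r = 0 then c else 0 : ℤ) : EisensteinRoot.CoeffDisc D) := fun c r => by
    rcases Nat.eq_zero_or_pos r with rfl | hr
    · rw [pow_zero, mul_one, if_pos rfl, hfermat]
    · rw [mul_pow, ← pow_mul]
      simp only [map_mul, map_pow, hπϱ, zero_pow (Nat.mul_ne_zero hr.ne' hp0), mul_zero, if_neg hr.ne', Int.cast_zero, map_zero]
  ext <;> simp only [WeierstrassCurve.map_a₁, WeierstrassCurve.map_a₂, WeierstrassCurve.map_a₃, WeierstrassCurve.map_a₄,
    WeierstrassCurve.map_a₆, map_zero, eq_intCast, hpow, zero_pow hp0]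

/-! ## §3 The cell corollaries -/

/-- The coefficient map `φ_D : 𝒪_D → ℂ_F` has norm `≤ 1`. [cite: SerreLocalFields1979, Ch. I §6 Prop. 18] -/
theorem norm_subtype_comp_toCBall_le_one (x : EisensteinRoot.CoeffDisc D) :
    ‖((CBall F).subtype.comp (EisensteinRoot.CoeffDisc.toCBall D)) x‖ ≤ 1 :=
  (mem_unitBall_iff _).mp (EisensteinRoot.CoeffDisc.toCBall D x).2

/-- `‖φ_D(ϖ)‖ = ‖ϖ‖` (the norm of the root in `ℂ_F`). [cite: SerreLocalFields1979, Ch. I §6 Prop. 17] -/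
theorem norm_subtype_comp_toCBall_root :
    ‖((CBall F).subtype.comp (EisensteinRoot.CoeffDisc.toCBall D)) (EisensteinRoot.CoeffDisc.of D (AdjoinRoot.root D.poly))‖ =
      ‖((D.rootC : integerC F) : CompletedAlgClosure F)‖ := by
  rw [RingHom.comp_apply, Subring.subtype_apply, EisensteinRoot.CoeffDisc.coe_toCBall, EisensteinRoot.Coeff.toF_root, EisensteinRoot.coe_rootC]

/-- ★ **The CM-fibre transport for the cell models**: every exact `[p]_{W_D}`-division tower of `Ŵ_D(𝔪_ℂ)` (`W_D = ⟨0,0,0,aϖ^{r₄},bϖ^{r₆}⟩`) has a unique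
exact `[p]_{E₀}`-division tower at distance `≤ ‖ϖ‖` (`E₀ = ⟨0,0,0,a[r₄=0],b[r₆=0]⟩`). [cite: Katz1981CrystallineDieudonne, Thm. 5.1.4–5.1.5]
[cite: Colmez1992PeriodesAbeliennes, §2] -/
theorem exists_unique_cmFibre_divisionSeq_explicitModel [Fact (¬ IsUnit (p : integerC F))] (a b : ℤ) (r₄ r₆ : ℕ)
    {v : ℕ → (maxNilIdealC F).toIdeal}
    (hv : ∀ n, AinfRamTop.mulPC (D := D)
      (⟨0, 0, 0, algebraMap ℤ (EisensteinRoot.CoeffDisc D) a * EisensteinRoot.CoeffDisc.of D (AdjoinRoot.root D.poly) ^ r₄,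
        algebraMap ℤ (EisensteinRoot.CoeffDisc D) b * EisensteinRoot.CoeffDisc.of D (AdjoinRoot.root D.poly) ^ r₆⟩ :
        WeierstrassCurve (EisensteinRoot.CoeffDisc D)) (v (n + 1)) = v n) :
    ∃! w : ℕ → (maxNilIdealC F).toIdeal,
      (∀ n, AinfTop.mulPC F p ((⟨0, 0, 0, if r₄ = 0 then a else 0, if r₆ = 0 then b else 0⟩ : WeierstrassCurve ℤ)) (w (n + 1)) = w n) ∧
      ∀ n, ‖(((w n : (maxNilIdealC F).toIdeal) : CBall F) : CompletedAlgClosure F) -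
        (((v n : (maxNilIdealC F).toIdeal) : CBall F) : CompletedAlgClosure F)‖ ≤ ‖((D.rootC : integerC F) : CompletedAlgClosure F)‖ :=
  exists_unique_int_divisionSeq_of_ramified D _ _ (map_explicitModel_eq_map_cmFibre D a b r₄ r₆) hv

section Cells

/-! The coefficient field is `ℂ_F`; its characteristic-zero instance (true: `charZero_of_injective_algebraMap` along `F → ℂ_F`, as used throughout the
tree via `haveI`) is taken as an instance ARGUMENT so that `log_{E₀} ∈ ℂ_F⟦X⟧` (which needs `Algebra ℚ ℂ_F`) can be named in statements. -/

variable [CharZero (CompletedAlgClosure F)]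

/-- ★ **`log_{E₀}` is of the second kind on the cell model `Ŵ_D`**: for `W = ⟨0,0,0,aϖ^{r₄},bϖ^{r₆}⟩`, `E₀ = ⟨0,0,0,a[r₄=0],b[r₆=0]⟩` and any `M ≥ 0` with
`‖ϖ‖^j ≤ M·‖j‖_{ℂ_F}` (`j ≥ 1`), every coefficient of `log_{E₀}(F_W(X,Y)) − log_{E₀}(X) − log_{E₀}(Y)` (read in `ℂ_F`) has norm `≤ M`.
[cite: Katz1981CrystallineDieudonne, Key Lemma 5.1.3 and Thm. 5.1.4] -/
theorem norm_coeff_formalLog_cocycle_le_explicitModel (a b : ℤ) (r₄ r₆ : ℕ) {M : ℝ} (hM0 : 0 ≤ M)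
    (hM : ∀ j : ℕ, 1 ≤ j → ‖((D.rootC : integerC F) : CompletedAlgClosure F)‖ ^ j ≤ M * ‖(j : CompletedAlgClosure F)‖)
    (d : Fin 2 →₀ ℕ) :
    ‖MvPowerSeries.coeff d
      (((⟨0, 0, 0, if r₄ = 0 then a else 0, if r₆ = 0 then b else 0⟩ : WeierstrassCurve ℤ).map
          (Int.castRingHom (CompletedAlgClosure F))).formalLog.subst
        (MvPowerSeries.map ((CBall F).subtype.comp (EisensteinRoot.CoeffDisc.toCBall D))
          (⟨0, 0, 0, algebraMap ℤ (EisensteinRoot.CoeffDisc D) a * EisensteinRoot.CoeffDisc.of D (AdjoinRoot.root D.poly) ^ r₄,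
            algebraMap ℤ (EisensteinRoot.CoeffDisc D) b * EisensteinRoot.CoeffDisc.of D (AdjoinRoot.root D.poly) ^ r₆⟩ :
            WeierstrassCurve (EisensteinRoot.CoeffDisc D)).formalGroupLaw) -
      ((⟨0, 0, 0, if r₄ = 0 then a else 0, if r₆ = 0 then b else 0⟩ : WeierstrassCurve ℤ).map
          (Int.castRingHom (CompletedAlgClosure F))).formalLog.subst (MvPowerSeries.X 0 : MvPowerSeries (Fin 2) (CompletedAlgClosure F)) -
      ((⟨0, 0, 0, if r₄ = 0 then a else 0, if r₆ = 0 then b else 0⟩ : WeierstrassCurve ℤ).map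
          (Int.castRingHom (CompletedAlgClosure F))).formalLog.subst (MvPowerSeries.X 1 : MvPowerSeries (Fin 2) (CompletedAlgClosure F)))‖ ≤ M := by
  have hMc : ∀ j : ℕ, 1 ≤ j → ‖((CBall F).subtype.comp (EisensteinRoot.CoeffDisc.toCBall D))
      (EisensteinRoot.CoeffDisc.of D (AdjoinRoot.root D.poly))‖ ^ j ≤ M * ‖(j : CompletedAlgClosure F)‖ := fun j hj => by
    rw [norm_subtype_comp_toCBall_root]; exact hM j hj
  exact norm_coeff_formalLog_cocycle_le _ (norm_subtype_comp_toCBall_le_one D) _ _ _ (map_explicitModel_eq_map_cmFibre D a b r₄ r₆) hM0 hMc d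

/-- ★ **`log_{E₀}(Xᵖ)` is of the second kind on the cell model `Ŵ_D`**: same setting, with `M_p ≥ 0` such that `‖p‖^j ≤ M_p‖j‖`; every coefficient of
`log_{E₀}(F_W(X,Y)ᵖ) − log_{E₀}(Xᵖ) − log_{E₀}(Yᵖ)` has norm `≤ max(M_p, M)`. [cite: Katz1981CrystallineDieudonne, Key Lemma 5.1.3 and Thm. 5.1.4] -/
theorem norm_coeff_formalLog_pow_cocycle_le_explicitModel (a b : ℤ) (r₄ r₆ : ℕ) {Mp M : ℝ} (hMp0 : 0 ≤ Mp) (hM0 : 0 ≤ M)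
    (hMp : ∀ j : ℕ, 1 ≤ j → ‖(p : CompletedAlgClosure F)‖ ^ j ≤ Mp * ‖(j : CompletedAlgClosure F)‖)
    (hM : ∀ j : ℕ, 1 ≤ j → ‖((D.rootC : integerC F) : CompletedAlgClosure F)‖ ^ j ≤ M * ‖(j : CompletedAlgClosure F)‖)
    (d : Fin 2 →₀ ℕ) :
    ‖MvPowerSeries.coeff d
      (((⟨0, 0, 0, if r₄ = 0 then a else 0, if r₆ = 0 then b else 0⟩ : WeierstrassCurve ℤ).map
          (Int.castRingHom (CompletedAlgClosure F))).formalLog.subst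
        (MvPowerSeries.map ((CBall F).subtype.comp (EisensteinRoot.CoeffDisc.toCBall D))
          (⟨0, 0, 0, algebraMap ℤ (EisensteinRoot.CoeffDisc D) a * EisensteinRoot.CoeffDisc.of D (AdjoinRoot.root D.poly) ^ r₄,
            algebraMap ℤ (EisensteinRoot.CoeffDisc D) b * EisensteinRoot.CoeffDisc.of D (AdjoinRoot.root D.poly) ^ r₆⟩ :
            WeierstrassCurve (EisensteinRoot.CoeffDisc D)).formalGroupLaw ^ p) -
      ((⟨0, 0, 0, if r₄ = 0 then a else 0, if r₆ = 0 then b else 0⟩ : WeierstrassCurve ℤ).map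
          (Int.castRingHom (CompletedAlgClosure F))).formalLog.subst ((MvPowerSeries.X 0 : MvPowerSeries (Fin 2) (CompletedAlgClosure F)) ^ p) -
      ((⟨0, 0, 0, if r₄ = 0 then a else 0, if r₆ = 0 then b else 0⟩ : WeierstrassCurve ℤ).map
          (Int.castRingHom (CompletedAlgClosure F))).formalLog.subst ((MvPowerSeries.X 1 : MvPowerSeries (Fin 2) (CompletedAlgClosure F)) ^ p))‖ ≤
      max Mp M := by
  have hMc : ∀ j : ℕ, 1 ≤ j → ‖((CBall F).subtype.comp (EisensteinRoot.CoeffDisc.toCBall D))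
      (EisensteinRoot.CoeffDisc.of D (AdjoinRoot.root D.poly))‖ ^ j ≤ M * ‖(j : CompletedAlgClosure F)‖ := fun j hj => by
    rw [norm_subtype_comp_toCBall_root]; exact hM j hj
  refine norm_coeff_formalLog_pow_cocycle_le _ (norm_subtype_comp_toCBall_le_one D) (not_isUnit_natCast_coeffDisc D) _ _ _ ?_ hMp0 hM0 hMp hMc d
  have h := map_frobeniusTwist_explicitModel_eq_map_cmFibre D a b r₄ r₆
  simpa only [eq_intCast] using h

end Cells

end Literature.NumberTheory.PAdicHodge
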